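/-
Copyright (c) 2026 the pub-hodgecm-mathlib formalisation cell (harness21).  Prover seat hodgecm-mathlib-K2E1b-p03 (g0), Track B ∕ K2-LIT (stream 29),
h413 = `stmt-HodgeConjecture-24833`, line `K2_E1b_GKCohomologyU21`, U0 file #5 — payment of `…U0.sig_K2E1bKTypeTwistGK` TOKEN FOR TOKEN.  2026-09-03.
-/
import Summits.HodgeConjecture.HodgeConjecture.Theorems.K2E1bKTypeTwistDefs
import HarnessLib

/-!
# h413 ∕ Track B «K2-LIT», line `K2_E1b_GKCohomologyU21`, unit U0 «TWIST INTEGRATION», file #5: TWISTED `K`-INTEGRATION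
# (payment of `Cruxes/H413/Lines/K2_E1b_GKCohomologyU21_U0_TwistIntegration.lean :: sig_K2E1bKTypeTwistGK`, statement bytes frozen)

Cell `pub/hodgecm-mathlib`, crux H413 = `stmt-HodgeConjecture-24833`, route of record `HCCMUnconditional`; chair K2-lead (g0), dealer
K2E1b-plan (g0), EMIT «SKELETON LANDED K2E1b» (REQUESTS l.72387) file #5 `sig_K2E1bKTypeTwistGK` (L) ↦ seat K2E1b-p03; SIGS TABLE row #5
(«+ `kTypeMatTwist` ∕ `kTypeRepTwist` defs inside»).  Namespace `Summit.HodgeConjecture.HodgeConjecture.Cruxes.H413.K2E1bKTypeTwistGK`.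
Honest definitions with bodies (`kTypeMatTw`, `kTypeImgTw`, `kTypeEndTw`, `kTypeRepTw` — the twisted copies of ★ `F0P3bKTypeIntegration`'s
`kTypeMat`, `kTypeImg`, `kTypeEnd`, `kTypeRep`) and theorems; no `instance`, no `notation`, no named-fact hypothesis, no `sorry`.
Imports: the ★ defs leaf `Theorems/K2E1bKTypeTwistDefs` (`ActsOnKTypesTwist`; it carries ★ `F0P3bKTypeIntegrationGK`) + HarnessLib.
Lane `--supports stmt-HodgeConjecture-24833 --as helper` (count-neutral; one of the eight U0 sockets behind `sig_K2E1bDatumCohUnitaryIrrep`).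

THE STATEMENT (bytes of the socket).  For `S ⊂ ℤ²` and a central exponent `e ∈ ℤ` with `1 ≤ n`, `6 ∣ m − 3n + 3 + 2e` on `S`, and a real Lie
algebra representation `ρ𝔤` of `𝔲(2,1)` on `V = ⊕_{(n,m) ∈ S} V_{n,m}` (basis `u^k_{n,m}`, `1 ≤ k ≤ n`; ★ `KIdx`, ★ `kvec`) whose restriction to
`𝔨 = 𝔲(2) ⊕ 𝔲(1)` acts by the TWISTED `u`-basis formulas ★ `ActsOnKTypesTwist S e ρ𝔤` (Kovačević's §3 Def. 1 coefficients plus the central term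
`(e∕3)·tr(X)·u^k`), SOME representation `ρK` of `K = U(2) × U(1)` on `V` makes `(ρK, ρ𝔤)` a `(𝔤, K)`-module and preserves every `K`-type `V_{n,m}`.

THE MATHEMATICS (Borel–Wallach 0 §2.5, VI §4 4.7–4.8; Kovačević §3 Def. 1, §6; the `e = 0` case is ★ `isGKModule_kTypeRep`).  On `V_{n,m}` the
twisted formulas are the differential of the `K`-type `det(k₁₁)^{a′} ⊗ u(k)^{b′} ⊗ Sym^{n−1}(k₁₁)` with the SHIFTED exponents `a′ = (m − 3n + 3 + 2e)∕6`,
`b′ = (e − m)∕3` (integral iff `6 ∣ m − 3n + 3 + 2e`): along `X = diag(X₁₁, x₂₂) ∈ 𝔨` its derivative is `a′·tr X₁₁ + b′·x₂₂ = [a·tr X₁₁ + b·x₂₂] +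
(e∕3)·tr X` with ★'s `a = (m − 3n + 3)∕6`, `b = −m∕3` (`diag_coeff_tw`).  In the `u`-basis (★ `cnorm`) the matrix of `ρK(g)|V_{n,m}` is
`kTypeMatTw e n m g = diag(cnorm)⁻¹ · upqKTypeCoeff (n−1) a′ b′ g · diag(cnorm)` (★ `F0P3bKTypeCalculus`); §1–§3 repeat ★ `F0P3bKTypeIntegration` §3–§5
for it VERBATIM (the representation `kTypeRepTw S e`, `K`-finiteness, weak continuity), §4 repeats ★ `F0P3bKTypeIntegrationGK` §2 (weak derivative
along `𝔨` by ★ `tri_sum` + `diag_coeff_tw`; `Ad`-compatibility by ★ `IsGKModule.of_hasWeakDeriv_of_expK_surjective` + ★ `upq_exists_expK_eq`), and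
§5 is the socket, TOKEN FOR TOKEN, with the witness `ρK := kTypeRepTw S e`.

WHY NOT A CHARACTER TWIST OF ★ `kTypeRep` (strategy).  ★ `GKTwist.isGKModule` twists by a character `χ` of `K` whose differential is bracket-killing
on `𝔤`, i.e. `χ = det^p`, `p ∈ ℤ`, shifting `(a, b)` by `(p, p)`; the shift needed here is `p = e∕3` (not integral when `3 ∤ e`, and relabelling `m`
cannot compensate), so the `K`-matrices with exponents `(a′, b′)` are built directly.

Tie probe at home (importing the U0 socket module): `K2/K2E1b-p03/g0/Probe_K2E1bKTypeTwistGK.lean`,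
`example : type_of% @KTypeTwistGK = type_of% @K2E1bGKCohomologyU21.U0.sig_K2E1bKTypeTwistGK := rfl`.
WHAT IS NOT HERE.  Admissibility (file #6, any `K`-type-preserving `ρK`), the twist `σ` of a Kovačević datum and its `𝔨`-formulas (#3, #4),
χ-scalars ∕ Hermitian form ∕ irreducibility (#7–#9).

HONEST LABEL.  HC_CM is proved only modulo the 7 printed citations (2 remaining named inputs: hLiu418 = `stmt-HodgeConjecture-24832`, h413 =
`stmt-HodgeConjecture-24833`) until rung 0 closes; this file moves no counter.

## References
* [BorelWallach2000] A. Borel, N. Wallach (2000), 0 §2.5 (`(𝔤, K)`-modules), VI §4 4.7–4.8 (`K`-types of the cohomological `U(2,1)`-modules).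
* [Kovacevic2021] D. Kovačević (2021), §3 Def. 1, §6.  [KnappVogan1995] A. W. Knapp, D. A. Vogan (1995), §II.3 (2.38) (character twists).
-/

noncomputable section

set_option linter.dupNamespace false -- the mandated namespace repeats the single-problem summit's segment (`HodgeConjecture.HodgeConjecture`)
set_option autoImplicit false

namespace Summit.HodgeConjecture.HodgeConjecture.Cruxes.H413.K2E1bKTypeTwistGK

open Literature.NumberTheory.Automorphic Literature.RepresentationTheory.BorelWallach2000
open Literature.RepresentationTheory.KonnoKonno2007 Literature.RepresentationTheory.KonnoKonno2007.RealDualPair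
  Literature.RepresentationTheory.KonnoKonno2007.RealDualPair.UForm
open Summit.HodgeConjecture.HodgeConjecture.Cruxes.H413.F0P3bSymPowerDerivation (dSymPowerMat)
open Summit.HodgeConjecture.HodgeConjecture.Cruxes.H413.F0P3bKTypeCalculus
open Summit.HodgeConjecture.HodgeConjecture.Cruxes.H413.F0P3bKTypeIntegration (KIdx kvec kvec_of_pos kvec_of_neg kvec_eq_single
  single_eq_kvec cnorm cnorm_ne_zero cnorm_div_self)
open Summit.HodgeConjecture.HodgeConjecture.Cruxes.H413.F0P3bKTypeIntegrationGK (tri_sum)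
open Summit.HodgeConjecture.HodgeConjecture.Cruxes.H413.K2E1bGKCohomologyU21 (ActsOnKTypesTwist)

-- Mathlib idiom (as in `GKModules`, ★ `F0P3bKTypeIntegration(GK)`, the defs leaf): commutator bracket on `Module.End`, needed to STATE the
-- socket's own type `𝔤 →ₗ⁅ℝ⁆ Module.End ℂ V`
attribute [local instance 100] LieRing.ofAssociativeRing

/-! ## §1 The twisted `K`-type matrix on `V_{n,m}`: `cnorm⁻¹ · (det^{a′} u^{b′} Sym^{n−1}) · cnorm`, `a′ = (m−3n+3+2e)∕6`, `b′ = (e−m)∕3` -/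

section KType

/-- **The matrix of the TWISTED `K`-action `ρK(g)|V_{n,m}` in the `u`-basis**: `(cnorm i ∕ cnorm l) · upqKTypeCoeff (n−1) a′ b′ g l i`,
`a′ = (m − 3n + 3 + 2e)∕6`, `b′ = (e − m)∕3` (for `e = 0` this is ★ `kTypeMat n m g`). [cite: BorelWallach2000, VI §4 4.7–4.8] [cite: Kovacevic2021, §6] -/
def kTypeMatTw (e n m : ℤ) (g : (uFormGroup (Fin 2) (Fin 1)).maximalCompact) :
    Matrix (Fin ((n - 1).toNat + 1)) (Fin ((n - 1).toNat + 1)) ℂ :=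
  Matrix.of fun l i => cnorm ((n - 1).toNat) i / cnorm ((n - 1).toNat) l *
    upqKTypeCoeff ((n - 1).toNat) ((m - 3 * n + 3 + 2 * e) / 6) ((e - m) / 3) g l i

/-- Unfolding, entrywise. [cite: BorelWallach2000, VI §4 4.7–4.8] -/
theorem kTypeMatTw_apply (e n m : ℤ) (g : (uFormGroup (Fin 2) (Fin 1)).maximalCompact) (l i : Fin ((n - 1).toNat + 1)) :
    kTypeMatTw e n m g l i = cnorm ((n - 1).toNat) i / cnorm ((n - 1).toNat) l *
      upqKTypeCoeff ((n - 1).toNat) ((m - 3 * n + 3 + 2 * e) / 6) ((e - m) / 3) g l i := rfl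

/-- `kTypeMatTw e n m 1 = 1`. [cite: BorelWallach2000, VI §4 4.7–4.8] -/
theorem kTypeMatTw_one (e n m : ℤ) : kTypeMatTw e n m 1 = 1 := by
  ext l i
  rw [kTypeMatTw_apply, upqKTypeCoeff_one, Matrix.one_apply]
  by_cases h : l = i
  · subst h
    rw [if_pos rfl, mul_one, cnorm_div_self (Nat.le_of_lt_succ l.2)]
  · rw [if_neg h, mul_zero]

/-- **Multiplicativity** (★ `upqKTypeCoeff_mul`; the `cnorm`-ratios telescope). [cite: BorelWallach2000, VI §4 4.7–4.8] -/
theorem kTypeMatTw_mul (e n m : ℤ) (g h : (uFormGroup (Fin 2) (Fin 1)).maximalCompact) :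
    kTypeMatTw e n m (g * h) = kTypeMatTw e n m g * kTypeMatTw e n m h := by
  ext l i
  rw [kTypeMatTw_apply, upqKTypeCoeff_mul, Matrix.mul_apply, Matrix.mul_apply, Finset.mul_sum]
  refine Finset.sum_congr rfl fun j _ => ?_
  rw [kTypeMatTw_apply, kTypeMatTw_apply]
  have hj : cnorm ((n - 1).toNat) j ≠ 0 := cnorm_ne_zero (Nat.le_of_lt_succ j.2)
  field_simp

/-- Continuity of the entries `g ↦ kTypeMatTw e n m g l i` on `K` (★ `continuous_upqKTypeCoeff_apply`). [cite: BorelWallach2000, 0 §2.5] -/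
theorem continuous_kTypeMatTw_apply (e n m : ℤ) (l i : Fin ((n - 1).toNat + 1)) :
    Continuous fun g : (uFormGroup (Fin 2) (Fin 1)).maximalCompact => kTypeMatTw e n m g l i := by
  simp only [kTypeMatTw_apply]
  exact continuous_const.mul (continuous_upqKTypeCoeff_apply _ _ _ l i)

/-- **The derivative of the entries along `exp tX`, `X ∈ 𝔨`** (★ `hasDerivAt_upqKTypeCoeff_expK`, shifted exponents). [cite: BorelWallach2000, 0 §2.5] -/
theorem hasDerivAt_kTypeMatTw_expK (e n m : ℤ) (X : (uFormGroup (Fin 2) (Fin 1)).compactLie) (l i : Fin ((n - 1).toNat + 1)) :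
    HasDerivAt (fun t : ℝ => kTypeMatTw e n m ((uFormGroup (Fin 2) (Fin 1)).expK (t • X)) l i)
      (cnorm ((n - 1).toNat) i / cnorm ((n - 1).toNat) l *
        (((((m - 3 * n + 3 + 2 * e) / 6 : ℤ) : ℂ) * ((X : Matrix (Fin 2 ⊕ Fin 1) (Fin 2 ⊕ Fin 1) ℂ).toBlocks₁₁).trace +
            (((e - m) / 3 : ℤ) : ℂ) * (X : Matrix (Fin 2 ⊕ Fin 1) (Fin 2 ⊕ Fin 1) ℂ).toBlocks₂₂ 0 0) * (if l = i then 1 else 0) +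
          dSymPowerMat ((n - 1).toNat) ((X : Matrix (Fin 2 ⊕ Fin 1) (Fin 2 ⊕ Fin 1) ℂ).toBlocks₁₁) l i)) 0 := by
  simp only [kTypeMatTw_apply]
  exact (hasDerivAt_upqKTypeCoeff_expK _ _ _ X l i).const_mul _

end KType

/-! ## §2 The twisted `K`-action on `V = ⊕ V_{n,m}` -/

section Action

variable (S : Set (ℤ × ℤ)) (e : ℤ)

/-- **The image of `u^k_{n,m}` under `g ∈ K`** (twisted): `Σ_l kTypeMatTw e n m g l (k−1) • u^{l+1}_{n,m}`. [cite: BorelWallach2000, VI §4 4.7–4.8] -/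
def kTypeImgTw (g : (uFormGroup (Fin 2) (Fin 1)).maximalCompact) : KIdx S → (KIdx S →₀ ℂ)
  | ⟨(n, m, k), h⟩ => ∑ l : Fin ((n - 1).toNat + 1),
      kTypeMatTw e n m g l ⟨(k - 1).toNat, by obtain ⟨-, h1, h2⟩ := h; dsimp only at h1 h2; omega⟩ •
        kvec S n m ((l : ℕ) + 1)

/-- **The twisted `K`-action `ρK(g)` on `V`** as a linear map (linear extension of `kTypeImgTw`). [cite: BorelWallach2000, 0 §2.5] -/
def kTypeEndTw (g : (uFormGroup (Fin 2) (Fin 1)).maximalCompact) : (KIdx S →₀ ℂ) →ₗ[ℂ] (KIdx S →₀ ℂ) :=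
  Finsupp.linearCombination ℂ (kTypeImgTw S e g)

variable {S} {e}

/-- `ρK(g)` on a basis vector. [cite: BorelWallach2000, 0 §2.5] -/
theorem kTypeEndTw_single (g : (uFormGroup (Fin 2) (Fin 1)).maximalCompact) (t : KIdx S) (c : ℂ) :
    kTypeEndTw S e g (Finsupp.single t c) = c • kTypeImgTw S e g t := by
  rw [kTypeEndTw, Finsupp.linearCombination_single]

/-- `ρK(g) v = Σ_{t ∈ supp v} v_t • kTypeImgTw g t`. [cite: BorelWallach2000, 0 §2.5] -/
theorem kTypeEndTw_apply (g : (uFormGroup (Fin 2) (Fin 1)).maximalCompact) (v : KIdx S →₀ ℂ) :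
    kTypeEndTw S e g v = ∑ t ∈ v.support, v t • kTypeImgTw S e g t := by
  rw [kTypeEndTw, Finsupp.linearCombination_apply]
  rfl

/-- **`ρK(g) u^{j+1}_{n,m} = Σ_l kTypeMatTw e n m g l j • u^{l+1}_{n,m}`** (`Fin`-indexed form). [cite: BorelWallach2000, VI §4 4.7–4.8] -/
theorem kTypeEndTw_kvec (g : (uFormGroup (Fin 2) (Fin 1)).maximalCompact) {n m : ℤ} (hnm : (n, m) ∈ S) (hn : 1 ≤ n)
    (j : Fin ((n - 1).toNat + 1)) :
    kTypeEndTw S e g (kvec S n m ((j : ℕ) + 1)) =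
      ∑ l : Fin ((n - 1).toNat + 1), kTypeMatTw e n m g l j • kvec S n m ((l : ℕ) + 1) := by
  have hj := j.2
  have h : (n, m) ∈ S ∧ (1 : ℤ) ≤ (j : ℕ) + 1 ∧ ((j : ℕ) : ℤ) + 1 ≤ n := ⟨hnm, by omega, by omega⟩
  rw [kvec_of_pos h, kTypeEndTw_single, one_smul]
  change (∑ l : Fin ((n - 1).toNat + 1),
      kTypeMatTw e n m g l ⟨((((j : ℕ) : ℤ) + 1) - 1).toNat, _⟩ • kvec S n m ((l : ℕ) + 1)) = _
  refine Finset.sum_congr rfl fun l _ => ?_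
  congr 2
  exact Fin.ext (by simp)

/-- `ρK(1) = id`. [cite: BorelWallach2000, 0 §2.5] -/
theorem kTypeEndTw_one : kTypeEndTw S e 1 = 1 := by
  refine Finsupp.lhom_ext fun t c => ?_
  obtain ⟨⟨n, m, k⟩, hS, hk, hkn⟩ := t
  dsimp only at hS hk hkn
  rw [Module.End.one_apply, kTypeEndTw_single]
  change c • (∑ l : Fin ((n - 1).toNat + 1),
      kTypeMatTw e n m 1 l ⟨(k - 1).toNat, _⟩ • kvec S n m ((l : ℕ) + 1)) = _
  rw [kTypeMatTw_one, Finset.sum_eq_single (⟨(k - 1).toNat, by omega⟩ : Fin ((n - 1).toNat + 1))]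
  · rw [Matrix.one_apply_eq, one_smul, kvec_eq_single ⟨(n, m, k), hS, hk, hkn⟩ (by simp; omega),
      Finsupp.smul_single_one]
  · intro l _ hl
    rw [Matrix.one_apply_ne hl, zero_smul]
  · intro h
    exact absurd (Finset.mem_univ _) h

/-- `ρK(g h) = ρK(g) ρK(h)`. [cite: BorelWallach2000, 0 §2.5] -/
theorem kTypeEndTw_mul (g h : (uFormGroup (Fin 2) (Fin 1)).maximalCompact) :
    kTypeEndTw S e (g * h) = kTypeEndTw S e g * kTypeEndTw S e h := by
  refine Finsupp.lhom_ext fun t c => ?_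
  obtain ⟨⟨n, m, k⟩, hS, hk, hkn⟩ := t
  dsimp only at hS hk hkn
  rw [Module.End.mul_apply, kTypeEndTw_single, kTypeEndTw_single, map_smul]
  congr 1
  change (∑ l : Fin ((n - 1).toNat + 1), kTypeMatTw e n m (g * h) l ⟨(k - 1).toNat, _⟩ • kvec S n m ((l : ℕ) + 1)) =
    kTypeEndTw S e g (∑ j : Fin ((n - 1).toNat + 1), kTypeMatTw e n m h j ⟨(k - 1).toNat, _⟩ • kvec S n m ((j : ℕ) + 1))
  rw [map_sum]
  simp_rw [map_smul, kTypeEndTw_kvec g hS (by omega), Finset.smul_sum, smul_smul]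
  rw [Finset.sum_comm]
  refine Finset.sum_congr rfl fun l _ => ?_
  rw [← Finset.sum_smul, kTypeMatTw_mul, Matrix.mul_apply]
  congr 1
  exact Finset.sum_congr rfl fun _ _ => mul_comm _ _

variable (S) (e)

/-- **The twisted representation `ρK : K →* End V`**, `det^{a′} ⊗ u^{b′} ⊗ Sym^{n−1}` on `V_{n,m}` in the `u`-basis. [cite: BorelWallach2000, 0 §2.5] -/
def kTypeRepTw : Representation ℂ (uFormGroup (Fin 2) (Fin 1)).maximalCompact (KIdx S →₀ ℂ) where
  toFun := kTypeEndTw S e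
  map_one' := kTypeEndTw_one
  map_mul' := kTypeEndTw_mul

variable {S} {e}

/-- Unfolding. [cite: BorelWallach2000, 0 §2.5] -/
@[simp] theorem kTypeRepTw_apply (g : (uFormGroup (Fin 2) (Fin 1)).maximalCompact) : kTypeRepTw S e g = kTypeEndTw S e g := rfl

end Action

/-! ## §3 `K`-finiteness and weak continuity -/

section Finite

variable {S : Set (ℤ × ℤ)} {e : ℤ}

/-- The image of a basis vector lies in the block of its `K`-type `{u^1_{n,m}, …, u^n_{n,m}}` (a finite set). [cite: Kovacevic2021, §3 Def. 1] -/
theorem kTypeImgTw_mem_span (g : (uFormGroup (Fin 2) (Fin 1)).maximalCompact) (t : KIdx S) :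
    kTypeImgTw S e g t ∈ Submodule.span ℂ
      (Set.range fun l : Fin ((t.1.1 - 1).toNat + 1) => kvec S t.1.1 t.1.2.1 ((l : ℕ) + 1)) := by
  obtain ⟨⟨n, m, k⟩, hS, hk, hkn⟩ := t
  change (∑ l : Fin ((n - 1).toNat + 1), kTypeMatTw e n m g l ⟨(k - 1).toNat, _⟩ • kvec S n m ((l : ℕ) + 1)) ∈ _
  exact Submodule.sum_mem _ fun l _ => Submodule.smul_mem _ _ (Submodule.subset_span ⟨l, rfl⟩)

/-- **`K`-finiteness**: the `K`-orbit of `v` lies in the span of the finitely many blocks through `supp v`. [cite: BorelWallach2000, 0 §2.5] -/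
theorem finiteDimensional_span_orbitTw (v : KIdx S →₀ ℂ) :
    FiniteDimensional ℂ (Submodule.span ℂ
      (Set.range fun g : (uFormGroup (Fin 2) (Fin 1)).maximalCompact => kTypeRepTw S e g v)) := by
  classical
  set B : Set (KIdx S →₀ ℂ) := ⋃ t ∈ (v.support : Set (KIdx S)),
    Set.range fun l : Fin ((t.1.1 - 1).toNat + 1) => kvec S t.1.1 t.1.2.1 ((l : ℕ) + 1) with hB
  have hBfin : B.Finite := Set.Finite.biUnion (Finset.finite_toSet _) fun t _ => Set.finite_range _
  haveI : FiniteDimensional ℂ (Submodule.span ℂ B) := FiniteDimensional.span_of_finite ℂ hBfin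
  refine Submodule.finiteDimensional_of_le (S₂ := Submodule.span ℂ B) (Submodule.span_le.mpr ?_)
  rintro _ ⟨g, rfl⟩
  refine (?_ : kTypeRepTw S e g v ∈ Submodule.span ℂ B)
  rw [kTypeRepTw_apply, kTypeEndTw_apply]
  refine Submodule.sum_mem _ fun t ht => Submodule.smul_mem _ _ ?_
  refine Submodule.span_mono ?_ (kTypeImgTw_mem_span g t)
  exact Set.subset_biUnion_of_mem (u := fun t : KIdx S =>
    Set.range fun l : Fin ((t.1.1 - 1).toNat + 1) => kvec S t.1.1 t.1.2.1 ((l : ℕ) + 1)) (Finset.mem_coe.mpr ht)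

/-- The matrix coefficient of a basis vector: `ℓ (kTypeImgTw g t) = Σ_l kTypeMatTw … g l (k−1) · ℓ (u^{l+1})`. [cite: BorelWallach2000, 0 §2.5] -/
theorem apply_kTypeImgTw (ℓ : Module.Dual ℂ (KIdx S →₀ ℂ)) (g : (uFormGroup (Fin 2) (Fin 1)).maximalCompact)
    (n m k : ℤ) (h : (n, m) ∈ S ∧ 1 ≤ k ∧ k ≤ n) :
    ℓ (kTypeImgTw S e g ⟨(n, m, k), h⟩) = ∑ l : Fin ((n - 1).toNat + 1),
      kTypeMatTw e n m g l ⟨(k - 1).toNat, by obtain ⟨-, -, h2⟩ := h; omega⟩ * ℓ (kvec S n m ((l : ℕ) + 1)) := by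
  change ℓ (∑ l : Fin ((n - 1).toNat + 1), kTypeMatTw e n m g l ⟨(k - 1).toNat, _⟩ • kvec S n m ((l : ℕ) + 1)) = _
  rw [map_sum]
  refine Finset.sum_congr rfl fun l _ => ?_
  rw [map_smul, smul_eq_mul]

/-- **Weak continuity**: every matrix coefficient `g ↦ ℓ (ρK(g) v)` is continuous on `K`. [cite: BorelWallach2000, 0 §2.5] -/
theorem continuous_coeffTw (v : KIdx S →₀ ℂ) (ℓ : Module.Dual ℂ (KIdx S →₀ ℂ)) :
    Continuous fun g : (uFormGroup (Fin 2) (Fin 1)).maximalCompact => ℓ (kTypeRepTw S e g v) := by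
  simp only [kTypeRepTw_apply, kTypeEndTw_apply, map_sum, map_smul, smul_eq_mul]
  refine continuous_finsetSum _ fun t _ => continuous_const.mul ?_
  obtain ⟨⟨n, m, k⟩, h⟩ := t
  simp only [apply_kTypeImgTw]
  exact continuous_finsetSum _ fun l _ => (continuous_kTypeMatTw_apply e n m l _).mul continuous_const

end Finite

/-! ## §4 The weak derivative along `𝔨` under `ActsOnKTypesTwist`, and the `(𝔤, K)`-module -/

section GK

variable {S : Set (ℤ × ℤ)} {e : ℤ}

/-- **The twisted diagonal** (`a′ = (m − 3n + 3 + 2e)∕6`, `b′ = (e − m)∕3`, `N = n − 1`, `i = k − 1`): `a′(x₀₀ + x₁₁) + b′x₂₂ + (N − i)x₀₀ + i x₁₁`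
is Kovačević's `𝔨`-diagonal coefficient PLUS the central term `(e∕3)(x₀₀ + x₁₁ + x₂₂)` (★ `diag_coeff` is `e = 0`). [cite: Kovacevic2021, §3 Def. 1] -/
theorem diag_coeff_tw {n m : ℤ} (h6 : (6 : ℤ) ∣ m - 3 * n + 3 + 2 * e) {N : ℕ} (hN : (N : ℤ) = n - 1) (i : ℕ) {k : ℤ}
    (hk : (i : ℤ) = k - 1) (x₀₀ x₁₁ x₂₂ : ℂ) :
    (((m - 3 * n + 3 + 2 * e) / 6 : ℤ) : ℂ) * (x₀₀ + x₁₁) + (((e - m) / 3 : ℤ) : ℂ) * x₂₂ + ((N : ℂ) - i) * x₀₀ + (i : ℂ) * x₁₁ =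
      (2 * x₀₀ - x₁₁ - x₂₂) / 3 * ((n : ℂ) + 1 - 2 * k) + (x₀₀ + x₁₁ - 2 * x₂₂) / 3 * (((m : ℂ) - n - 1 + 2 * k) / 2)
        + ((e : ℂ) / 3) * (x₀₀ + x₁₁ + x₂₂) := by
  have h3 : (3 : ℤ) ∣ e - m := by omega
  have ha : (((m - 3 * n + 3 + 2 * e) / 6 : ℤ) : ℂ) * 6 = (m : ℂ) - 3 * n + 3 + 2 * e := by exact_mod_cast Int.ediv_mul_cancel h6
  have hb : (((e - m) / 3 : ℤ) : ℂ) * 3 = (e : ℂ) - m := by exact_mod_cast Int.ediv_mul_cancel h3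
  have hN' : (N : ℂ) = (n : ℂ) - 1 := by exact_mod_cast hN
  have hi' : (i : ℂ) = (k : ℂ) - 1 := by exact_mod_cast hk
  linear_combination (x₀₀ + x₁₁) / 6 * ha + x₂₂ / 3 * hb + x₀₀ * hN' + (x₁₁ - x₀₀) * hi'

/-- **The weak derivative along `𝔨` (twisted)**: under `ActsOnKTypesTwist S e ρ𝔤`, `d/dt|₀ ℓ (ρK (exp tX) v) = ℓ (ρ𝔤 X v)` for `X ∈ 𝔨`,
`ρK = kTypeRepTw S e` (★ `tri_sum` off the diagonal, `diag_coeff_tw` on it). [cite: BorelWallach2000, 0 §2.5] [cite: Kovacevic2021, §3 Def. 1] -/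
theorem hasDerivAt_coeffTw (hS : ∀ n m : ℤ, (n, m) ∈ S → 1 ≤ n ∧ (6 : ℤ) ∣ m - 3 * n + 3 + 2 * e)
    (ρ𝔤 : (uFormGroup (Fin 2) (Fin 1)).lie →ₗ⁅ℝ⁆ Module.End ℂ (KIdx S →₀ ℂ))
    (hρ : ActsOnKTypesTwist S e ρ𝔤)
    (X : (uFormGroup (Fin 2) (Fin 1)).compactLie) (v : KIdx S →₀ ℂ) (ℓ : Module.Dual ℂ (KIdx S →₀ ℂ)) :
    HasDerivAt (fun t : ℝ => ℓ (kTypeRepTw S e ((uFormGroup (Fin 2) (Fin 1)).expK (t • X)) v))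
      (ℓ (ρ𝔤 (LieSubalgebra.inclusion (uFormGroup (Fin 2) (Fin 1)).compactLie_le_lie X) v)) 0 := by
  classical
  set X₁ := (X : Matrix (Fin 2 ⊕ Fin 1) (Fin 2 ⊕ Fin 1) ℂ).toBlocks₁₁ with hX₁
  set X₂ := (X : Matrix (Fin 2 ⊕ Fin 1) (Fin 2 ⊕ Fin 1) ℂ).toBlocks₂₂ with hX₂
  have hv : v = ∑ t ∈ v.support, v t • Finsupp.single t (1 : ℂ) := by
    conv_lhs => rw [← Finsupp.sum_single v]
    simp only [Finsupp.sum, Finsupp.smul_single_one]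
  have hfun : (fun t : ℝ => ℓ (kTypeRepTw S e ((uFormGroup (Fin 2) (Fin 1)).expK (t • X)) v)) =
      fun t : ℝ => ∑ s ∈ v.support, v s * ℓ (kTypeImgTw S e ((uFormGroup (Fin 2) (Fin 1)).expK (t • X)) s) := by
    funext t
    rw [kTypeRepTw_apply, kTypeEndTw_apply, map_sum]
    simp only [map_smul, smul_eq_mul]
  have hval : ℓ (ρ𝔤 (LieSubalgebra.inclusion (uFormGroup (Fin 2) (Fin 1)).compactLie_le_lie X) v) =
      ∑ s ∈ v.support, v s * ℓ (ρ𝔤 (LieSubalgebra.inclusion (uFormGroup (Fin 2) (Fin 1)).compactLie_le_lie X)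
        (Finsupp.single s 1)) := by
    conv_lhs => rw [hv]
    rw [map_sum, map_sum]
    simp only [map_smul, smul_eq_mul]
  rw [hfun, hval]
  refine HasDerivAt.fun_sum fun s _ => HasDerivAt.const_mul (v s) ?_
  obtain ⟨⟨n, m, k⟩, hnm, hk1, hkn⟩ := s
  dsimp only at hnm hk1 hkn
  obtain ⟨hn1, h6⟩ := hS n m hnm
  -- the derivative of the coefficient as a `Fin`-sum (entrywise ★ `hasDerivAt_upqKTypeCoeff_expK`), then ★ `tri_sum` + `diag_coeff_tw`
  simp only [apply_kTypeImgTw]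
  refine (HasDerivAt.fun_sum fun l _ => (hasDerivAt_kTypeMatTw_expK e n m X l _).mul_const _).congr_deriv ?_
  set N : ℕ := (n - 1).toNat with hNdef
  have hN : (N : ℤ) = n - 1 := Int.toNat_of_nonneg (by omega)
  have hiN : (k - 1).toNat < N + 1 := by omega
  set i : Fin (N + 1) := ⟨(k - 1).toNat, hiN⟩ with hidef
  have hi : ((i : ℕ) : ℤ) = k - 1 := Int.toNat_of_nonneg (by omega)
  set s : ℂ := (((m - 3 * n + 3 + 2 * e) / 6 : ℤ) : ℂ) * X₁.trace + (((e - m) / 3 : ℤ) : ℂ) * X₂ 0 0 with hsdef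
  set w : ℤ → ℂ := fun j => ℓ (kvec S n m j) with hwdef
  have hw : w ((N : ℤ) + 2) = 0 := by
    simp only [hwdef]
    rw [kvec_of_neg (by omega), map_zero]
  have htri := tri_sum N i X₁ s w hw
  have hlhs : (∑ l : Fin (N + 1), cnorm N ((k - 1).toNat) / cnorm N l *
      (s * (if l = i then 1 else 0) + dSymPowerMat N X₁ l i) * ℓ (kvec S n m ((l : ℕ) + 1))) =
      ∑ l : Fin (N + 1), cnorm N i / cnorm N l * (s * (if l = i then 1 else 0) + dSymPowerMat N X₁ l i) *
        w ((l : ℕ) + 1) := rfl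
  rw [hlhs, htri, single_eq_kvec, hρ X n m k hnm hk1 hkn]
  simp only [map_add, map_smul, smul_eq_mul]
  have hw1 : w ((i : ℕ) + 1) = ℓ (kvec S n m k) := by simp only [hwdef]; rw [show ((i : ℕ) : ℤ) + 1 = k by omega]
  have hw2 : w (i : ℕ) = ℓ (kvec S n m (k - 1)) := by simp only [hwdef]; rw [hi]
  have hw3 : w ((i : ℕ) + 2) = ℓ (kvec S n m (k + 1)) := by simp only [hwdef]; rw [show ((i : ℕ) : ℤ) + 2 = k + 1 by omega]
  rw [hw1, hw2, hw3]
  have hdiag := diag_coeff_tw h6 hN (i : ℕ) hi (X₁ 0 0) (X₁ 1 1) (X₂ 0 0)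
  have htr : X₁.trace = X₁ 0 0 + X₁ 1 1 := Matrix.trace_fin_two X₁
  have e00 : X₁ 0 0 = (X : Matrix (Fin 2 ⊕ Fin 1) (Fin 2 ⊕ Fin 1) ℂ) (Sum.inl 0) (Sum.inl 0) := rfl
  have e01 : X₁ 0 1 = (X : Matrix (Fin 2 ⊕ Fin 1) (Fin 2 ⊕ Fin 1) ℂ) (Sum.inl 0) (Sum.inl 1) := rfl
  have e10 : X₁ 1 0 = (X : Matrix (Fin 2 ⊕ Fin 1) (Fin 2 ⊕ Fin 1) ℂ) (Sum.inl 1) (Sum.inl 0) := rfl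
  have e11 : X₁ 1 1 = (X : Matrix (Fin 2 ⊕ Fin 1) (Fin 2 ⊕ Fin 1) ℂ) (Sum.inl 1) (Sum.inl 1) := rfl
  have e22 : X₂ 0 0 = (X : Matrix (Fin 2 ⊕ Fin 1) (Fin 2 ⊕ Fin 1) ℂ) (Sum.inr 0) (Sum.inr 0) := rfl
  have hi' : ((i : ℕ) : ℂ) = (k : ℂ) - 1 := by exact_mod_cast hi
  have hN' : (N : ℂ) = (n : ℂ) - 1 := by exact_mod_cast hN
  rw [← e00, ← e01, ← e10, ← e11, ← e22, hsdef, htr]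
  rw [hi', hN'] at hdiag ⊢
  linear_combination ℓ (kvec S n m k) * hdiag

/-- **TWISTED `K`-INTEGRATION.**  With `1 ≤ n`, `6 ∣ m − 3n + 3 + 2e` on `S` and `ActsOnKTypesTwist S e ρ𝔤`, the twisted `K`-action
`kTypeRepTw S e` makes `(ρK, ρ𝔤)` a `(𝔤, K)`-module of `U(2,1)` (`Ad`-compatibility by ★ `IsGKModule.of_hasWeakDeriv_of_expK_surjective` + ★
`upq_exists_expK_eq`); ★ `isGKModule_kTypeRep` is `e = 0`. [cite: BorelWallach2000, 0 §2.5; VI §4 4.7–4.8] [cite: Kovacevic2021, §3 Def. 1; §6] -/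
theorem isGKModule_kTypeRepTw (hS : ∀ n m : ℤ, (n, m) ∈ S → 1 ≤ n ∧ (6 : ℤ) ∣ m - 3 * n + 3 + 2 * e)
    (ρ𝔤 : (uFormGroup (Fin 2) (Fin 1)).lie →ₗ⁅ℝ⁆ Module.End ℂ (KIdx S →₀ ℂ)) (hρ : ActsOnKTypesTwist S e ρ𝔤) :
    IsGKModule (uFormGroup (Fin 2) (Fin 1)) (kTypeRepTw S e) ρ𝔤 :=
  IsGKModule.of_hasWeakDeriv_of_expK_surjective upq_exists_expK_eq finiteDimensional_span_orbitTw continuous_coeffTw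
    (hasDerivAt_coeffTw hS ρ𝔤 hρ)

/-- **The twisted `K`-action preserves every `K`-type `V_{n,m} = span_l u^l_{n,m}`** (off the labels `u^k_{n,m} = 0`). [cite: BorelWallach2000, 0 §2.5] -/
theorem kTypeRepTw_kvec_mem_span (g : (uFormGroup (Fin 2) (Fin 1)).maximalCompact) (n m k : ℤ) :
    kTypeRepTw S e g (kvec S n m k) ∈ Submodule.span ℂ (Set.range fun l : ℤ => kvec S n m l) := by
  by_cases h : (n, m) ∈ S ∧ 1 ≤ k ∧ k ≤ n
  · rw [kvec_of_pos h, kTypeRepTw_apply, kTypeEndTw_single, one_smul]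
    change (∑ l : Fin ((n - 1).toNat + 1), kTypeMatTw e n m g l ⟨(k - 1).toNat, _⟩ • kvec S n m ((l : ℕ) + 1)) ∈ _
    exact Submodule.sum_mem _ fun l _ => Submodule.smul_mem _ _ (Submodule.subset_span ⟨((l : ℕ) : ℤ) + 1, rfl⟩)
  · rw [kvec_of_neg h, map_zero]
    exact Submodule.zero_mem _

end GK

/-! ## §5 The socket `sig_K2E1bKTypeTwistGK`, token for token -/

/-- **Socket #5 `sig_K2E1bKTypeTwistGK` of `Cruxes/H413/Lines/K2_E1b_GKCohomologyU21_U0_TwistIntegration.lean` (statement bytes frozen).**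
TWISTED `K`-INTEGRATION: if `1 ≤ n` and `6 ∣ m − 3n + 3 + 2e` on `S` and `ρ𝔤|_𝔨` acts by the twisted `u`-basis formulas, then SOME `K`-action
preserving every `K`-type `V_{n,m}` makes `(ρK, ρ𝔤)` a `(𝔤, K)`-module of `U(2,1)` — witness `ρK := kTypeRepTw S e` (`det(g₁₁)^{a′} u^{b′} Sym^{n−1}`
in the `u`-basis, `a′ = (m − 3n + 3 + 2e)∕6`, `b′ = (e − m)∕3`), by `isGKModule_kTypeRepTw` and `kTypeRepTw_kvec_mem_span`.
[cite: BorelWallach2000, 0 §2.5; VI §4 4.7–4.8] [cite: Kovacevic2021, §3 Def. 1; §6] -/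
theorem KTypeTwistGK :
    ∀ (S : Set (ℤ × ℤ)) (e : ℤ), (∀ n m : ℤ, (n, m) ∈ S → 1 ≤ n ∧ (6 : ℤ) ∣ m - 3 * n + 3 + 2 * e) →
      ∀ (ρ𝔤 : (uFormGroup (Fin 2) (Fin 1)).lie →ₗ⁅ℝ⁆ Module.End ℂ (KIdx S →₀ ℂ)), ActsOnKTypesTwist S e ρ𝔤 →
        ∃ ρK : Representation ℂ (uFormGroup (Fin 2) (Fin 1)).maximalCompact (KIdx S →₀ ℂ),
          IsGKModule (uFormGroup (Fin 2) (Fin 1)) ρK ρ𝔤 ∧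
            ∀ (g : (uFormGroup (Fin 2) (Fin 1)).maximalCompact) (n m k : ℤ),
              ρK g (kvec S n m k) ∈ Submodule.span ℂ (Set.range fun l : ℤ => kvec S n m l) := by
  intro S e hS ρ𝔤 hρ
  exact ⟨kTypeRepTw S e, isGKModule_kTypeRepTw hS ρ𝔤 hρ, kTypeRepTw_kvec_mem_span⟩

end Summit.HodgeConjecture.HodgeConjecture.Cruxes.H413.K2E1bKTypeTwistGK

end
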